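import Mathlib
import HarnessLib
import Summits.HubbardSuperconductivity.HubbardSuperconductivity.Theorems.BalabanIRBirGappedPhaseReductionRSlavedTrotterCore

/-!
# BalabanIR reduction `BirGappedPhaseReductionR` (stmt-14846): the slaved pair-field representation — Trotter exactness and (R) for free

Support file (`--supports stmt-HubbardSuperconductivity-14846`; prover seat 2, session 11) for the
crux card `slaved-pair-field-os-dictionary` (crux-ideate r1 ideator 1, passed by both triagers of
`Cruxes/BirGappedPhaseReductionR/TRIAGE-r1-{1,2}.md`), whose two typed first lemmas
(`Cruxes/BirGappedPhaseReductionR/SketchIdeator1.lean`, namespace `…Cruxes.….Ideator1`) are proved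
here with their bodies spelled out verbatim (the Cruxes module is not importable from `Theorems/`):

* `slavedPairFieldTrotter` = `Ideator1.SlavedPairFieldTrotter` — **exactness of the slaved
  representation.** Add the pair penalty `(κ/2){B, Bᴴ}` to `H` and subtract it again by averaging the
  HERMITIAN source slice `exp(aκ(φ̄ B + φ Bᴴ))` over the U(1)-symmetric four-point surrogate
  `ν₄ = {r·iᵏ}_{k<4}`, `r² = 1/(κa)`, of the complex Gaussian: in the Trotter limit `a = β/(M+1) → 0`
  one recovers `tr e^{-βH}` exactly, for ANY matrix `B` (no sign, size or commutation hypothesis)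
  and in fact for any `H` (Hermiticity is not used) — we prove convergence of the MATRICES
  (`tendsto_slavedProduct`), not only of their traces;
* `posDef_avgSourceSlice` — after averaging, the source slice is positive definite (RP in time);
* `slavedWeightTimeReflection` = `Ideator1.SlavedWeightTimeReflection` — **(R) for free.** The
  complex weight `W(φ₁,…,φ_M) = tr Π_τ [e^{-aH'} e^{aκ(φ̄_τ B + φ_τ Bᴴ)}]` of a pair-field history
  satisfies `conj W(φ₁,…,φ_M) = W(φ_M,…,φ₁)` when `H` is Hermitian (both slice factors are then
  Hermitian; adjoint reverses the time order; the invertible factor `e^{-aH'}` conjugates the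
  reversed product back into the slaved form) — the table-level hypothesis (R) of the restated engine
  `BirComplexStableXYR`, automatic for weights of Hamiltonian origin.

Mechanism of the first (proved in the companion CORE file
`Theorems/BalabanIRBirGappedPhaseReductionRSlavedTrotterCore.lean`; the finite-dimensional heart of
every auxiliary-field / Hubbard–Stratonovich Trotter decomposition, Blankenbecler–Scalapino–Sugar 1981,
Hirsch 1983, here with an exact four-point quadrature instead of a Gaussian or Ising field): the
moments of `ν₄` are
`E φ = E φ² = E φ̄² = 0`, `E|φ|² = r²` and all third moments vanish, so the averaged slice is
`S̄ = 1 + (aκ/2){B,Bᴴ} + O((aκ)^{3/2} r³‖B‖³) = 1 + (aκ/2){B,Bᴴ} + O(a^{3/2})`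
(`norm_exp_sub_one_sub_sub_le`, third-order Taylor remainder), the penalty cancels to this order,
`‖e^{-aH'} S̄ - e^{-aH}‖ ≤ C · a (a κ r + a) = O(a^{3/2})` (`exists_norm_slavedSlice_sub_gibbsWeight_le`),
and Chernoff's product formula (`tendsto_pow_succ_of_norm_sub_exp_le`, tree) turns the per-slice
`O(a^{3/2})` into the global `O(β a^{1/2}) → 0`. Matrices carry the `L²` operator norm
(`open scoped Matrix.Norms.L2Operator`), a C⋆-norm with `‖1‖ = 1`.

What this buys the line (TRIAGE-r1-1 §1 "slaved", T6; TRIAGE-r1-2): before averaging, the integrand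
is the complex, (R)-Hermitian weight of a pair-field history (the object a restated engine acts on);
after averaging each slice operator `e^{-aH'/2} S̄ e^{-aH'/2}` is positive definite (RP in time,
`Theorems…TimeRP.posSemidef_timeReflectedTrace`), with no `Z ≠ 0` clause needed. The crux-sized
stubs of that line (MEMBERSHIP of the induced action in the engine class; the ENGINE itself) are not
touched here.
-/

noncomputable section

namespace Summit.HubbardSuperconductivity.HubbardSuperconductivity.Theorems

open scoped Matrix.Norms.L2Operator ComplexConjugate ComplexOrder
open Matrix Filter Topology NormedSpace
open Literature.MathematicalPhysics.QuantumLattice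

variable {n : Type*} [Fintype n] [DecidableEq n]

/-! ### The Trotter limit (Chernoff) -/

/-- **Slaved pair-field product formula (matrix form).** For any `n × n` matrices `H, B` and
`κ, β > 0`, with `a = β/(M+1)`, `r = ((M+1)/(κβ))^{1/2}` and `φ_k = r iᵏ`,
`(e^{-a(H + (κ/2){B,Bᴴ})} · ¼Σ_{k<4} e^{aκ(conj φ_k B + φ_k Bᴴ)})^{M+1} → e^{-βH}` as `M → ∞`
(per-slice error `O(a^{3/2})` by `exists_norm_slavedSlice_sub_gibbsWeight_le`, summed by Chernoff's
product formula `tendsto_pow_succ_of_norm_sub_exp_le`). [folklore] -/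
theorem tendsto_slavedProduct (H B : Matrix n n ℂ) {κ β : ℝ} (hκ : 0 < κ) (hβ : 0 < β) :
    Tendsto (fun M : ℕ =>
      (gibbsWeight (β / ((M : ℝ) + 1)) (H + ((κ / 2 : ℝ) : ℂ) • (B * Bᴴ + Bᴴ * B)) *
        ((1 / 4 : ℂ) • ∑ k : Fin 4, gibbsWeight (-(β / ((M : ℝ) + 1) * κ))
          (conj ((Real.sqrt (((M : ℝ) + 1) / (κ * β)) : ℂ) * Complex.I ^ (k : ℕ)) • B +
            ((Real.sqrt (((M : ℝ) + 1) / (κ * β)) : ℂ) * Complex.I ^ (k : ℕ)) • Bᴴ))) ^ (M + 1))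
      atTop (𝓝 (gibbsWeight β H)) := by
  rcases isEmpty_or_nonempty n with hn | hn
  · have hsub : Subsingleton (Matrix n n ℂ) := inferInstance
    rw [show (fun M : ℕ =>
      (gibbsWeight (β / ((M : ℝ) + 1)) (H + ((κ / 2 : ℝ) : ℂ) • (B * Bᴴ + Bᴴ * B)) *
        ((1 / 4 : ℂ) • ∑ k : Fin 4, gibbsWeight (-(β / ((M : ℝ) + 1) * κ))
          (conj ((Real.sqrt (((M : ℝ) + 1) / (κ * β)) : ℂ) * Complex.I ^ (k : ℕ)) • B +
            ((Real.sqrt (((M : ℝ) + 1) / (κ * β)) : ℂ) * Complex.I ^ (k : ℕ)) • Bᴴ))) ^ (M + 1))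
        = fun _ => gibbsWeight β H from funext fun _ => Subsingleton.elim _ _]
    exact tendsto_const_nhds
  obtain ⟨C, hC⟩ := exists_norm_slavedSlice_sub_gibbsWeight_le H B hκ.le
  -- name the two parameter sequences WITHOUT unfolding them in the goal
  obtain ⟨a, ha⟩ : ∃ a : ℕ → ℝ, ∀ M : ℕ, β / ((M : ℝ) + 1) = a M :=
    ⟨fun M => β / ((M : ℝ) + 1), fun _ => rfl⟩
  obtain ⟨r, hr⟩ : ∃ r : ℕ → ℝ, ∀ M : ℕ, Real.sqrt (((M : ℝ) + 1) / (κ * β)) = r M :=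
    ⟨fun M => Real.sqrt (((M : ℝ) + 1) / (κ * β)), fun _ => rfl⟩
  simp only [ha, hr]
  have hM : ∀ M : ℕ, (0 : ℝ) < (M : ℝ) + 1 := fun M => by positivity
  have ha0 : ∀ M, 0 < a M := fun M => by rw [← ha]; exact div_pos hβ (hM M)
  have hr0 : ∀ M, 0 ≤ r M := fun M => by rw [← hr]; exact Real.sqrt_nonneg _
  have hakr : ∀ M, a M * κ * r M ^ 2 = 1 := fun M => by
    rw [← hr, ← ha, Real.sq_sqrt (by positivity)]
    field_simp
  have ha_t : Tendsto a atTop (𝓝 0) := by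
    have e : a = fun M : ℕ => β * (1 / ((M : ℝ) + 1)) := funext fun M => by rw [← ha]; ring
    rw [e]
    simpa using (tendsto_one_div_add_atTop_nhds_zero_nat).const_mul β
  have ha1 : ∀ᶠ M : ℕ in atTop, a M ≤ 1 := ha_t.eventually (ge_mem_nhds one_pos)
  -- the exact slice is `exp ((M+1)⁻¹ • (-β H)) = e^{-a_M H}`
  have hexact : ∀ M : ℕ, exp ((((M + 1 : ℕ) : ℂ))⁻¹ • (-(β : ℂ) • H)) = gibbsWeight (a M) H := by
    intro M
    rw [gibbsWeight, smul_smul, ← ha]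
    congr 1
    push_cast
    field_simp
  have key := tendsto_pow_succ_of_norm_sub_exp_le (𝕂 := ℂ) (-(β : ℂ) • H)
    (fun M : ℕ => gibbsWeight (a M) (H + ((κ / 2 : ℝ) : ℂ) • (B * Bᴴ + Bᴴ * B)) *
        ((1 / 4 : ℂ) • ∑ k : Fin 4, gibbsWeight (-(a M * κ))
          (conj (((r M : ℝ) : ℂ) * Complex.I ^ (k : ℕ)) • B +
            (((r M : ℝ) : ℂ) * Complex.I ^ (k : ℕ)) • Bᴴ)))
    (fun M => C * (a M * (a M * κ * r M + a M))) ?_ ?_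
  · rw [show gibbsWeight β H = exp (-(β : ℂ) • H) from rfl]
    exact key
  · filter_upwards [ha1] with M hM1
    rw [hexact M]
    exact hC (a M) (r M) (ha0 M).le hM1 (hr0 M) (hakr M)
  · -- `(M+1) · C a_M (s_M + a_M) = C β (s_M + a_M) → 0`, `s_M = (κ a_M)^{1/2}`
    have hs : ∀ M, a M * κ * r M = Real.sqrt (κ * a M) := fun M => by
      have h2 : (a M * κ * r M) ^ 2 = κ * a M := by
        have e : (a M * κ * r M) ^ 2 = (a M * κ) * (a M * κ * r M ^ 2) := by ring
        rw [e, hakr M, mul_one, mul_comm]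
      rw [← h2, Real.sqrt_sq (by have := (ha0 M).le; have := hr0 M; positivity)]
    have hs_t : Tendsto (fun M => a M * κ * r M) atTop (𝓝 0) := by
      simp only [hs]
      simpa using (ha_t.const_mul κ).sqrt
    have hsum_t : Tendsto (fun M => C * β * (a M * κ * r M + a M)) atTop (𝓝 0) := by
      simpa using (hs_t.add ha_t).const_mul (C * β)
    refine hsum_t.congr fun M => ?_
    have e : ((M : ℝ) + 1) * a M = β := by rw [← ha]; field_simp
    calc C * β * (a M * κ * r M + a M) = C * (((M : ℝ) + 1) * a M) * (a M * κ * r M + a M) := by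
          rw [e]
      _ = ((M : ℝ) + 1) * (C * (a M * (a M * κ * r M + a M))) := by ring

/-- **`SlavedPairFieldTrotter` (card `slaved-pair-field-os-dictionary`, first lemma; body verbatim from
`Cruxes/BirGappedPhaseReductionR/SketchIdeator1.lean` with `penalised`, `sourceSlice`, `nu4`
unfolded).** In the Trotter limit the slaved representation reproduces the Gibbs trace exactly:
`tr[(e^{-aH'} · ¼Σ_k e^{aκ(φ̄_k B + φ_k Bᴴ)})^{M+1}] → tr e^{-βH}`, `a = β/(M+1)`,
`H' = H + (κ/2)(BBᴴ + BᴴB)`, `φ_k = r iᵏ`, `r = ((M+1)/(κβ))^{1/2}`, for ANY matrix `B`; the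
Hermiticity hypothesis of the card's statement is not needed (kept for literal agreement).
[folklore] -/
theorem slavedPairFieldTrotter :
    ∀ (n : Type) [Fintype n] [DecidableEq n] (H B : Matrix n n ℂ), H.IsHermitian →
      ∀ κ β : ℝ, 0 < κ → 0 < β →
        Tendsto (fun M : ℕ =>
            let a : ℝ := β / ((M : ℝ) + 1)
            let r : ℝ := Real.sqrt (((M : ℝ) + 1) / (κ * β))
            ((Matrix.gibbsWeight a (H + ((κ / 2 : ℝ) : ℂ) • (B * Bᴴ + Bᴴ * B)) *
                ((1 / 4 : ℂ) • ∑ k : Fin 4, Matrix.gibbsWeight (-(a * κ))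
                  ((starRingEnd ℂ ((r : ℂ) * Complex.I ^ (k : ℕ))) • B +
                    ((r : ℂ) * Complex.I ^ (k : ℕ)) • Bᴴ))) ^ (M + 1)).trace)
          atTop (𝓝 ((Matrix.gibbsWeight β H).trace)) := by
  intro n _ _ H B _ κ β hκ hβ
  exact ((continuous_id.matrix_trace).tendsto _).comp (tendsto_slavedProduct H B hκ hβ)

/-! ### (R) for free: time-reflection Hermiticity of the slaved weight -/

/-- Reversing `List.ofFn f` is `List.ofFn (f ∘ Fin.rev)`. [folklore] -/
theorem list_reverse_ofFn {α : Type*} {M : ℕ} (f : Fin M → α) :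
    (List.ofFn f).reverse = List.ofFn (fun i => f i.rev) := by
  apply List.ext_getElem
  · simp
  · intro i h1 h2
    simp only [List.getElem_reverse, List.getElem_ofFn, List.length_ofFn, Fin.rev]
    congr 1
    ext
    dsimp only
    omega

/-- Trace of a `G`-interleaved product is insensitive to the side of the interleaving when `G` is
invertible: `tr Π_τ (S_τ G) = tr Π_τ (G S_τ)` (indeed `G · Π(S_τ G) = Π(G S_τ) · G`). [folklore] -/
theorem trace_prod_map_mul_eq_trace_prod_map_mul' (G : Matrix n n ℂ) (hG : IsUnit G)
    (l : List (Matrix n n ℂ)) :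
    ((l.map fun S => S * G).prod).trace = ((l.map fun S => G * S).prod).trace := by
  have key : ∀ l : List (Matrix n n ℂ),
      G * (l.map fun S => S * G).prod = (l.map fun S => G * S).prod * G := by
    intro l
    induction l with
    | nil => simp
    | cons S l ih => simp only [List.map_cons, List.prod_cons, mul_assoc]; rw [ih]
  have hdet : IsUnit G.det := (Matrix.isUnit_iff_isUnit_det G).mp hG
  calc ((l.map fun S => S * G).prod).trace
      = (G⁻¹ * (G * (l.map fun S => S * G).prod)).trace := by
          rw [← mul_assoc, Matrix.nonsing_inv_mul _ hdet, one_mul]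
    _ = (G⁻¹ * ((l.map fun S => G * S).prod * G)).trace := by rw [key]
    _ = ((l.map fun S => G * S).prod * G * G⁻¹).trace := by rw [Matrix.trace_mul_comm]
    _ = ((l.map fun S => G * S).prod).trace := by rw [mul_assoc, Matrix.mul_nonsing_inv _ hdet, mul_one]

omit [Fintype n] [DecidableEq n] in
/-- The source exponent `conj φ • B + φ • Bᴴ` is Hermitian. [folklore] -/
theorem isHermitian_sourceExponent (φ : ℂ) (B : Matrix n n ℂ) :
    (conj φ • B + φ • Bᴴ).IsHermitian := by
  rw [IsHermitian, conjTranspose_add, conjTranspose_smul, conjTranspose_smul,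
    conjTranspose_conjTranspose]
  change conj (conj φ) • Bᴴ + conj φ • B = conj φ • B + φ • Bᴴ
  rw [Complex.conj_conj]
  exact add_comm _ _

omit [DecidableEq n] in
/-- The pair anticommutator `B Bᴴ + Bᴴ B` is Hermitian. [folklore] -/
theorem isHermitian_pairAnticommutator (B : Matrix n n ℂ) : (B * Bᴴ + Bᴴ * B).IsHermitian := by
  rw [IsHermitian, conjTranspose_add, conjTranspose_mul, conjTranspose_mul,
    conjTranspose_conjTranspose]

/-- **`SlavedWeightTimeReflection` (card `slaved-pair-field-os-dictionary`; body verbatim from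
`Cruxes/BirGappedPhaseReductionR/SketchIdeator1.lean` with `slavedWeight`, `penalised`,
`sourceSlice` unfolded).** (R) for free: the complex weight
`W(φ) = tr Π_τ [e^{-aH'} e^{aκ(φ̄_τ B + φ_τ Bᴴ)]` of a pair-field history satisfies
`conj W(φ₀,…,φ_{M-1}) = W(φ_{M-1},…,φ₀)` for Hermitian `H`: `conj tr X = tr Xᴴ`, the adjoint of
the ordered product is the reversed product of the adjoints `S_τ G` (both factors Hermitian), and
`tr Π (S_τ G) = tr Π (G S_τ)` since `G = e^{-aH'}` is invertible. This is exactly the table-level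
hypothesis (R) `c_{n∘R} = conj c_{-n}` of `BirComplexStableXYR` for weights of Hamiltonian origin
(Osterwalder–Schrader time reflection). [folklore] -/
theorem slavedWeightTimeReflection :
    ∀ (n : Type) [Fintype n] [DecidableEq n] (H B : Matrix n n ℂ), H.IsHermitian →
      ∀ (a κ : ℝ) (M : ℕ) (φs : Fin M → ℂ),
        starRingEnd ℂ
            ((List.ofFn (fun τ : Fin M =>
                Matrix.gibbsWeight a (H + ((κ / 2 : ℝ) : ℂ) • (B * Bᴴ + Bᴴ * B)) *
                  Matrix.gibbsWeight (-(a * κ)) ((starRingEnd ℂ (φs τ)) • B + (φs τ) • Bᴴ))).prod.trace)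
          = (List.ofFn (fun τ : Fin M =>
                Matrix.gibbsWeight a (H + ((κ / 2 : ℝ) : ℂ) • (B * Bᴴ + Bᴴ * B)) *
                  Matrix.gibbsWeight (-(a * κ))
                    ((starRingEnd ℂ ((φs ∘ Fin.rev) τ)) • B + ((φs ∘ Fin.rev) τ) • Bᴴ))).prod.trace := by
  intro n _ _ H B hH a κ M φs
  set G : Matrix n n ℂ := Matrix.gibbsWeight a (H + ((κ / 2 : ℝ) : ℂ) • (B * Bᴴ + Bᴴ * B)) with hG_def
  set S : ℂ → Matrix n n ℂ := fun φ => Matrix.gibbsWeight (-(a * κ)) ((starRingEnd ℂ φ) • B + φ • Bᴴ)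
    with hS_def
  have hH' : (H + ((κ / 2 : ℝ) : ℂ) • (B * Bᴴ + Bᴴ * B)).IsHermitian := by
    refine hH.add ?_
    have h2 := (isHermitian_pairAnticommutator B)
    rw [IsHermitian, conjTranspose_smul, h2.eq, Complex.star_def, Complex.conj_ofReal]
  have hGh : G.IsHermitian := isHermitian_gibbsWeight a hH'
  have hSh : ∀ φ, (S φ).IsHermitian := fun φ =>
    isHermitian_gibbsWeight _ (isHermitian_sourceExponent φ B)
  have hGunit : IsUnit G := by rw [hG_def, gibbsWeight]; exact Matrix.isUnit_exp _
  -- adjoint of the ordered product = reversed product of `S_τ G`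
  have hstar : starRingEnd ℂ ((List.ofFn fun τ : Fin M => G * S (φs τ)).prod.trace) =
      ((List.ofFn fun τ : Fin M => S (φs (Fin.rev τ)) * G).prod).trace := by
    change star ((List.ofFn fun τ : Fin M => G * S (φs τ)).prod.trace) = _
    rw [← Matrix.trace_conjTranspose, Matrix.conjTranspose_list_prod, List.map_ofFn,
      list_reverse_ofFn]
    congr 1
    funext τ
    simp only [Function.comp_apply, conjTranspose_mul, (hSh _).eq, hGh.eq]
  show starRingEnd ℂ ((List.ofFn fun τ : Fin M => G * S (φs τ)).prod.trace) =
    ((List.ofFn fun τ : Fin M => G * S ((φs ∘ Fin.rev) τ)).prod.trace)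
  rw [hstar]
  have h1 : (List.ofFn fun τ : Fin M => S (φs (Fin.rev τ)) * G) =
      (List.ofFn fun τ : Fin M => S (φs (Fin.rev τ))).map (fun X => X * G) := by
    rw [List.map_ofFn]; rfl
  have h2 : (List.ofFn fun τ : Fin M => G * S ((φs ∘ Fin.rev) τ)) =
      (List.ofFn fun τ : Fin M => S (φs (Fin.rev τ))).map (fun X => G * X) := by
    rw [List.map_ofFn]; rfl
  rw [h1, h2]
  exact trace_prod_map_mul_eq_trace_prod_map_mul' G hGunit _

/-! ### Positivity after averaging (RP in time needs no `Z ≠ 0` clause) -/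

/-- After the `ν₄`-average the source slice `¼Σ_{k<4} e^{aκ(conj φ_k B + φ_k Bᴴ)}` is POSITIVE
DEFINITE (a positive combination of exponentials of Hermitian matrices), for every `a, κ, r` and
every `B`: together with `e^{-aH'} > 0` each averaged slice operator `e^{-aH'/2} S̄ e^{-aH'/2}` is
positive, which is the input of reflection positivity in time for the averaged representation
(`Theorems…TimeRP.posSemidef_timeReflectedTrace`). [folklore] -/
theorem posDef_avgSourceSlice (a κ r : ℝ) (B : Matrix n n ℂ) :
    ((1 / 4 : ℂ) • ∑ k : Fin 4, gibbsWeight (-(a * κ))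
      (conj ((r : ℂ) * Complex.I ^ (k : ℕ)) • B + ((r : ℂ) * Complex.I ^ (k : ℕ)) • Bᴴ)).PosDef := by
  have hS : (∑ k : Fin 4, gibbsWeight (-(a * κ))
      (conj ((r : ℂ) * Complex.I ^ (k : ℕ)) • B + ((r : ℂ) * Complex.I ^ (k : ℕ)) • Bᴴ)).PosDef :=
    Matrix.posDef_sum Finset.univ_nonempty fun k _ =>
      posDef_gibbsWeight _ (isHermitian_sourceExponent _ B)
  have h4 : (0 : ℂ) < 1 / 4 := by
    rw [show (1 / 4 : ℂ) = ((1 / 4 : ℝ) : ℂ) by push_cast; ring]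
    exact Complex.zero_lt_real.mpr (by norm_num)
  exact hS.smul h4

end Summit.HubbardSuperconductivity.HubbardSuperconductivity.Theorems

end
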